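import Literature.Geometry.Kaehler.ComplexTorusHodgeGroupProductCMEllipticCurves
import Literature.Geometry.Kaehler.ComplexTorusFiniteProduct
import Literature.FieldTheory.Kummer.QuadraticKummerSigns
import HarnessLib

/-!
# The Hodge group of a product of pairwise non-isogenous elliptic curves with complex multiplication:
# `Hg(E_{τ₁} × ⋯ × E_{τ_n}) = Hg(E_{τ₁}) × ⋯ × Hg(E_{τ_n}) (= U(1)ⁿ)`
# (Imai 1976, Proposition — the case of CM curves, any number of factors; Moonen–Zarhin 1999 §3 Corollary; torus level)

Layer `Literature/Geometry/Kaehler`, namespace `Literature.Geometry.Kaehler.ComplexTorus`; lane `lit-hodgefound`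
(Track 2 foundations library), Layer A4, self-proposed row «Q72⁺ · (Q424 lineage)⁺ · (`piPeriod`)⁺» of
`run/shared/lean/pub/lit-hodgefound/SKELETON.md` (prover seat p40, generation 6). Sequel of
`ComplexTorusHodgeGroupProductCMEllipticCurves.lean` (p22: the case of TWO CM curves on the binary product
`prodPeriod`, with its tools `mulMatrix` (`ρ_r(z) = Re z · 1 + Im z · J`), the complexified circle `cocharCurve`,
Zariski density along one-parameter groups `mem_ratZeroLocus_of_infinite`, the CM bookkeeping
`map_ratCast_imMatrix` / `im_sq_eq_of_quadratic` / `im_div_im_ne_ratCast_of_not_isIsogenous`), of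
`ComplexTorusHodgeGroupProduct.lean` (GGK III.B (i) `Hg(X₁ × X₂) ⊆ Hg(X₁) × Hg(X₂)` for `prodPeriod`), of
`ComplexTorusEllipticCurveHodgeGroup.lean` (`Hg(E_τ)(ℝ) = h(S¹)` for a CM curve,
`mem_hodgeGroup_ellipticPeriod_iff_of_quadratic`), of `ComplexTorusFiniteProduct.lean` (p18: the `n`-fold product
torus `piPeriod Φ` of a family `Φ : Fin n → (ℝ^ι ≃ E)`, index type `Fin n × ι`) and of
`Literature/FieldTheory/Kummer/QuadraticKummerSigns.lean` (the sign characters `εₖ(σ) = σ(√cₖ)/√cₖ` of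
`Gal(ℚ(√c₁, …, √c_n)/ℚ)`: Galois transport of `ℚ`-polynomial relations, distinctness, spanning). All consumed BY
NAME; nothing is restated.

## Sources, verbatim

* H. Imai, *On the Hodge groups of some abelian varieties*, Kōdai Math. Sem. Rep. **27** (1976) 367–372 (held
  `paper:doi-10-2996-kmj-1138847263`, page = printed page), §2, p. 368 L11–L13: "**PROPOSITION.** Let
  `Eᵢ = V_{iR}/Lᵢ` (`i = 1, 2, …, n`) be non-isogenous elliptic curves, then
  `Hg(E₁ × ⋯ × E_n) = Hg(E₁) × ⋯ × Hg(E_n)`." Proof, first case (p. 368 L17 – p. 369 L35): "Firstly we suppose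
  that all `Eᵢ` are of CM-type with CM-field `Kᵢ = Q(√-dᵢ)` […] we can represent `φᵢ(z)` (`z = a + b√-1`,
  `|z| = 1`, `a, b ∈ Q`) as […]. As `H ⊂ G₁ × ⋯ × G_n ≅ G_mⁿ`, `H` is defined by equations of following form
  […] `(*)` `∏ᵢ Xᵢ^{eᵢ} = 1` (`eᵢ ∈ Z`) […] We want to prove `eᵢ = 0` (`i = 1, ⋯, n`). […] As `H` is defined
  over `Q`, `h^σ ∈ H` for all `h ∈ H` and for all `σ ∈ Aut(C)`. Take primes `p₁, …, p_s` which devide some `dᵢ`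
  and take `σ ∈ Aut(C)` such that `σ(√p_j) = -√p_j` […]. Putting the point of `G` corresponding to
  `(φ₁(z)^σ, …, φ_n(z)^σ) ∈ H` in `(*)` (with `z = a + b√-1`, `a, b ∈ Q`, `|z| = 1`, hence `φᵢ(z)^σ = φᵢ(z)^{εᵢ}`
  where `εᵢ = ±1`), we have `(**)` […] We use the induction on `t` to prove `eᵢ = 0`".
* B. Moonen, Yu. Zarhin, *Hodge classes on abelian varieties of low dimension*, Math. Ann. **315** (1999) 711–733
  (held `paper:arxiv-math_9901113`), §3, p0007 L80–L88: "As an easy corollary we obtain a result first proven by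
  Imai. **Corollary.** Let `X₁, …, X_n` be elliptic curves over `ℂ`, no two of which are isogenous. Write
  `X = X₁ × ⋯ × X_n`. Then `Hg(X) = Hg(X₁) × ⋯ × Hg(X_n)`."; §1, p0002: "`Hg(X₁ × X₂) ⊂ Hg(X₁) × Hg(X₂)` and
  the two projections are surjective".
* M. Green, P. Griffiths, M. Kerr, *Mumford–Tate Groups and Domains* (2012), §III.B (i), p. 72:
  "`M_{φ₁+φ₂} ⊂ M_{φ₁} × M_{φ₂}`".
* H. Lange, *Abelian Varieties over the Complex Numbers* (2023), §7.2.1 p. 329 (definition of `Hg(X)` as the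
  smallest algebraic `ℚ`-subgroup `G` of `SL(V)` with `h(S¹) ⊆ G(ℝ)` — the tree's `hodgeGroup`, REAL POINTS).

## What is proved, and how (torus level, real points — Imai's first case for ANY number of CM curves)

For CM points `τ₀, …, τ_{n−1}` (`Im τₖ ≠ 0`, `τₖ² + pₖτₖ + qₖ = 0` over `ℚ`), `Φₖ = ellipticPeriod hτₖ`,
`X = ∏ₖ E_{τₖ} = piPeriod Φ` (`H₁(X, ℝ) = ℝ^(Fin n × Fin 2)`), `Hg(X)(ℝ) = hodgeGroup (piPeriod Φ)`:

* §1 **`n`-fold block-diagonal matrices** `piBlockDiag M = diag(M₀, …, M_{n−1})` on `Fin n × ι` (products,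
  determinant `∏ det Mₖ`, inverses), the embedding `piBlockDiagSL : (∏ₖ SL_ι(ℝ)) →* SL_{Fin n × ι}(ℝ)`,
  `jMatrix_piPeriod` / `hodgeCircle_piPeriod` (`J` and `h(e^{iθ})` of the product torus are block-diagonal), the
  equation families `offDiagEqsPi` / `liftEqsPi k P` / `piEqs k P` (`G ⊆ GL(Vₖ)` imposed on the `k`-th diagonal
  block of a block-diagonal matrix) and **GGK III.B (i) for finite products, `hodgeGroup_pi_le`:
  `Hg(∏ₖ Xₖ)(ℝ) ⊆ ∏ₖ Hg(Xₖ)(ℝ)`** (block-diagonally), for ANY family of complex tori `Xₖ = E/Φₖ(ℤ^ι)`.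
* §2 **The Galois step** (Imai p. 368 "`h^σ ∈ H` […] `φᵢ(z)^σ = φᵢ(z)^{εᵢ}`"). With `yₖ = Im τₖ`,
  `yₖ² = cₖ = qₖ − pₖ²/4 ∈ ℚ_{>0}` and the RATIONAL matrix `Nₖ = yₖ · Jₖ` (`map_ratCast_imMatrix`): for a
  rational point `z = a + bi` (`a, b ∈ ℚ`) of `S¹`, `h(e^{iθ_z}) = diag(a·1 + bJₖ) = diag(a·1 + (b/cₖ) yₖ Nₖ)` is
  the value at `u = y` of a matrix `𝓜(u)` with entries in `ℚ[u₁, …, u_n]`; so for `f ∈ P` (a `ℚ`-group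
  `G = V(P) ⊇ h(S¹)`) the polynomial `g = f(𝓜(u)) ∈ ℚ[u]` vanishes at `y`, hence (FILE 1,
  `aeval_algEquiv_gen_div_mul_eq_zero`) at `(εₖ(σ) yₖ)ₖ` for every `σ ∈ Gal(ℚ(y₁, …, y_n)/ℚ)`:
  **`piBlockDiag_mulMatrix_sign_mem_ratZeroLocus`** — `diag(ρₖ(a + εₖ(σ) b i)) ∈ G(ℝ)`.
* §3 **Zariski density and generation.** Along the twisted one-parameter group
  `u ↦ diag(νₖ(u^{εₖ(σ)}))` (complexified circles, `νₖ(e^{iθ}) = hₖ(e^{iθ})`) through the infinitely many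
  rational points `zₘ = (m + i)/(m − i)` of `S¹`, §2 + density give `diag(hₖ(e^{i εₖ(σ) θ})) ∈ G(ℝ)` for EVERY `θ`
  (`piBlockDiag_hodgeCircle_sign_mem_ratZeroLocus`); the sign characters `εₖ` are pairwise distinct because
  `yₖ yₗ ∉ ℚ` for `k ≠ l` — which is exactly `E_{τₖ} ≁ E_{τₗ}` (`im_mul_im_ne_ratCast_of_not_isIsogenous`) —
  so the vectors `ε(σ)` span `ℝⁿ` (FILE 1, `exists_eq_sum_mul_algEquiv_gen_div`) and products of the twisted
  circles exhaust `∏ₖ hₖ(S¹)`: **`piBlockDiagSL_hodgeCircleSL_mem_hodgeGroup_pi`** —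
  `diag(h₀(e^{iθ₀}), …, h_{n−1}(e^{iθ_{n−1}})) ∈ Hg(∏ₖ E_{τₖ})(ℝ)` for ALL `θ : Fin n → ℝ`.
* §4 **Imai's Proposition, CM case**: with §1 (`⊆`) and `Hg(E_{τₖ})(ℝ) = hₖ(S¹)` (CM, tree),
  **`hodgeGroup_pi_ellipticPeriod_eq`**:
  `Hg(E_{τ₀} × ⋯ × E_{τ_{n−1}})(ℝ) = piBlockDiagSL(∏ₖ Hg(E_{τₖ})(ℝ))` for pairwise non-isogenous CM curves, and
  the explicit description **`mem_hodgeGroup_pi_ellipticPeriod_iff`**: `M ∈ Hg(X)(ℝ) ⟺ M = diag(hₖ(e^{iθₖ}))`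
  for some `θ : Fin n → ℝ` (the real points of the rank-`n` torus `∏ₖ 𝕌_{ℚ(τₖ)}`). Validation (§5): three
  curves with CM by `ℚ(i)`, `ℚ(√−2)`, `ℚ(√−3)` (`τ = i, i√2, i√3`).

Imai's prime-by-prime induction on the character equations `(*)`/`(**)` is replaced by the Galois group of
the multiquadratic field `ℚ(Im τ₁, …, Im τ_n)` (the tree's Kummer theory, Lang *Algebra* VI §8) and Dedekind's
independence of characters — a shorter road to the same statement; the case distinction "`φᵢ(√-1)` =
multiplication by `±√-dᵢ ⊗ 1/√dᵢ`" (p. 368 L18–L21) disappears since `yₖ = Im τₖ` carries its own sign. Not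
here: Imai's second and third cases (factors without complex multiplication: `Hg(E) = SL₂`, Goursat / almost
direct products — p22's lineage `ComplexTorusEllipticCurveHodgeGroupNonCM.lean`), the isogenous case for `n`
factors (§3 Remarks, p. 370), and the surjectivity of the projections `Hg(∏ Xₖ) → Hg(Xₖ)`.

## References
* [Imai1976HodgeGroups] H. Imai, *On the Hodge groups of some abelian varieties*, Kōdai Math. Sem. Rep. 27
  (1976) 367–372, §2 Proposition (first case), §1 (`Hg(A₁ × A₂) ⊂ Hg(A₁) × Hg(A₂)`).
* [MoonenZarhin1999LowDim] B. Moonen, Yu. Zarhin, *Hodge classes on abelian varieties of low dimension*,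
  Math. Ann. 315 (1999), §3 Corollary.
* [GreenGriffithsKerr2012] M. Green, P. Griffiths, M. Kerr, *Mumford–Tate Groups and Domains*, Annals of
  Math. Studies 183 (2012), §III.B (i), p. 72.
* [Lange2023AbelianVarietiesComplex] H. Lange, *Abelian Varieties over the Complex Numbers*, Springer (2023),
  §7.2.1 (p. 329), Prop. 7.2.3 (proof: `h(z) = cos θ · 1 + sin θ · J`).
* [Lang2002] S. Lang, *Algebra*, GTM 211 (2002), VI §8 Thm. 8.1, VI §4 Thm. 4.1.
* [vanGeemen1994HodgeAV] B. van Geemen, *An introduction to the Hodge conjecture for abelian varieties*, LNM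
  1594 (1994), §6.3–6.7 (the points `G(L)` of an algebraic `ℚ`-group; one-parameter groups).
-/

noncomputable section

open scoped Real
open Complex Module Matrix
open ComplexConjugate

namespace Literature.Geometry.Kaehler

namespace ComplexTorus

/-! ## §1 `n`-fold block-diagonal matrices, `J` and `h(S¹)` of `∏ₖ Xₖ`, and GGK III.B (i) for finite products -/

section PiBlockDiag

variable {n : ℕ} {ι : Type*} {R : Type*}

/-- **The block-diagonal matrix `diag(M₀, …, M_{n−1})`** on the index type `Fin n × ι` of the product torus
`piPeriod` (block index FIRST): entry `((k, i), (l, j)) ↦ δ_{kl} (Mₖ)ᵢⱼ`. It is Mathlib's `blockDiagonal`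
reindexed by `prodComm` (`piBlockDiag_eq_reindex`). [cite: GreenGriffithsKerr2012, §III.B (i) (p. 72: `M_{φ₁} × M_{φ₂} ⊆ GL(V_{φ₁} ⊕ V_{φ₂})`)] -/
def piBlockDiag [Zero R] (M : Fin n → Matrix ι ι R) : Matrix (Fin n × ι) (Fin n × ι) R :=
  Matrix.of fun p q ↦ if p.1 = q.1 then M p.1 p.2 q.2 else 0

/-- Entries of `piBlockDiag`. [cite: GreenGriffithsKerr2012, §III.B (i) (p. 72)] -/
theorem piBlockDiag_apply [Zero R] (M : Fin n → Matrix ι ι R) (p q : Fin n × ι) :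
    piBlockDiag M p q = if p.1 = q.1 then M p.1 p.2 q.2 else 0 := rfl

/-- `piBlockDiag M` is `blockDiagonal M` with the two index factors exchanged. [cite: GreenGriffithsKerr2012, §III.B (i) (p. 72)] -/
theorem piBlockDiag_eq_reindex [Zero R] (M : Fin n → Matrix ι ι R) :
    piBlockDiag M = Matrix.reindex (Equiv.prodComm ι (Fin n)) (Equiv.prodComm ι (Fin n)) (Matrix.blockDiagonal M) := by
  ext ⟨k, i⟩ ⟨l, j⟩
  rfl

/-- The `k`-th diagonal block of a matrix on `Fin n × ι`. [cite: GreenGriffithsKerr2012, §III.B (i) (p. 72)] -/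
def piDiagBlock (M : Matrix (Fin n × ι) (Fin n × ι) R) (k : Fin n) : Matrix ι ι R :=
  Matrix.of fun i j ↦ M (k, i) (k, j)

/-- Entries of `piDiagBlock`. [cite: GreenGriffithsKerr2012, §III.B (i) (p. 72)] -/
@[simp] theorem piDiagBlock_apply (M : Matrix (Fin n × ι) (Fin n × ι) R) (k : Fin n) (i j : ι) :
    piDiagBlock M k i j = M (k, i) (k, j) := rfl

/-- The diagonal blocks of `diag(M₀, …, M_{n−1})` are the `Mₖ`. [cite: GreenGriffithsKerr2012, §III.B (i) (p. 72)] -/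
@[simp] theorem piDiagBlock_piBlockDiag [Zero R] (M : Fin n → Matrix ι ι R) (k : Fin n) :
    piDiagBlock (piBlockDiag M) k = M k := by
  ext i j
  simp [piBlockDiag_apply]

/-- `piBlockDiag` is injective. [cite: GreenGriffithsKerr2012, §III.B (i) (p. 72)] -/
theorem piBlockDiag_injective [Zero R] : Function.Injective (piBlockDiag : (Fin n → Matrix ι ι R) → _) :=
  fun M N h ↦ funext fun k ↦ by rw [← piDiagBlock_piBlockDiag M k, h, piDiagBlock_piBlockDiag]

/-- A matrix with vanishing off-diagonal blocks is the block-diagonal matrix of its diagonal blocks.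
[cite: GreenGriffithsKerr2012, §III.B (i) (p. 72)] -/
theorem piBlockDiag_piDiagBlock_of_offDiag_eq_zero [Zero R] {M : Matrix (Fin n × ι) (Fin n × ι) R}
    (h : ∀ p q : Fin n × ι, p.1 ≠ q.1 → M p q = 0) : piBlockDiag (piDiagBlock M) = M := by
  ext p q
  rw [piBlockDiag_apply]
  split_ifs with hpq
  · obtain ⟨k, i⟩ := p
    obtain ⟨l, j⟩ := q
    dsimp only at hpq
    subst hpq
    rfl
  · exact (h p q hpq).symm

/-- `diag(0, …, 0) = 0`. [cite: GreenGriffithsKerr2012, §III.B (i) (p. 72)] -/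
@[simp] theorem piBlockDiag_zero [Zero R] : piBlockDiag (0 : Fin n → Matrix ι ι R) = 0 := by
  ext p q; simp [piBlockDiag_apply]

/-- `piBlockDiag` is additive. [cite: GreenGriffithsKerr2012, §III.B (i) (p. 72)] -/
theorem piBlockDiag_add [AddZeroClass R] (M N : Fin n → Matrix ι ι R) :
    piBlockDiag (M + N) = piBlockDiag M + piBlockDiag N := by
  ext p q
  simp only [piBlockDiag_apply, Matrix.add_apply, Pi.add_apply]
  split_ifs <;> simp

/-- `piBlockDiag` commutes with scalars. [cite: GreenGriffithsKerr2012, §III.B (i) (p. 72)] -/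
theorem piBlockDiag_smul {S : Type*} [Zero R] [SMulZeroClass S R] (a : S) (M : Fin n → Matrix ι ι R) :
    piBlockDiag (a • M) = a • piBlockDiag M := by
  ext p q
  simp only [piBlockDiag_apply, Matrix.smul_apply, Pi.smul_apply]
  split_ifs <;> simp

/-- `piBlockDiag` commutes with entrywise maps preserving `0`: `diag(Mₖ).map f = diag((Mₖ).map f)`.
[cite: GreenGriffithsKerr2012, §III.B (i) (p. 72)] -/
theorem piBlockDiag_map {S : Type*} [Zero R] [Zero S] (M : Fin n → Matrix ι ι R) {f : R → S} (hf : f 0 = 0) :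
    (piBlockDiag M).map f = piBlockDiag fun k ↦ (M k).map f := by
  ext p q
  simp only [Matrix.map_apply, piBlockDiag_apply]
  split_ifs <;> simp [hf]

variable [Fintype ι] [DecidableEq ι]

omit [Fintype ι] in
/-- `diag(1, …, 1) = 1`. [cite: GreenGriffithsKerr2012, §III.B (i) (p. 72)] -/
@[simp] theorem piBlockDiag_one [Zero R] [One R] : piBlockDiag (fun _ : Fin n ↦ (1 : Matrix ι ι R)) = 1 := by
  ext ⟨k, i⟩ ⟨l, j⟩
  simp only [piBlockDiag_apply, Matrix.one_apply, Prod.mk.injEq]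
  by_cases h : k = l <;> by_cases h' : i = j <;> simp [h, h']

omit [DecidableEq ι] in
/-- **`diag(Mₖ) · diag(Nₖ) = diag(Mₖ Nₖ)`.** [cite: GreenGriffithsKerr2012, §III.B (i) (p. 72)] -/
theorem piBlockDiag_mul [NonUnitalNonAssocSemiring R] (M N : Fin n → Matrix ι ι R) :
    piBlockDiag M * piBlockDiag N = piBlockDiag fun k ↦ M k * N k := by
  rw [piBlockDiag_eq_reindex, piBlockDiag_eq_reindex, piBlockDiag_eq_reindex, Matrix.reindex_apply,
    Matrix.reindex_apply, Matrix.reindex_apply, Matrix.submatrix_mul_equiv, ← Matrix.blockDiagonal_mul]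

/-- **`det diag(M₀, …, M_{n−1}) = ∏ₖ det Mₖ`.** [cite: GreenGriffithsKerr2012, §III.B (i) (p. 72)] -/
theorem det_piBlockDiag [CommRing R] (M : Fin n → Matrix ι ι R) : (piBlockDiag M).det = ∏ k, (M k).det := by
  rw [piBlockDiag_eq_reindex, Matrix.det_reindex_self, Matrix.det_blockDiagonal]

omit [DecidableEq ι] in
/-- `diag(Mₖ)` acts block by block: `(diag(Mₖ) v)_{(k,·)} = Mₖ v_{(k,·)}`. [cite: GreenGriffithsKerr2012, §III.B (i) (p. 72)] -/
theorem piBlockDiag_mulVec [NonUnitalNonAssocSemiring R] (M : Fin n → Matrix ι ι R) (v : Fin n × ι → R)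
    (p : Fin n × ι) : (piBlockDiag M *ᵥ v) p = (M p.1 *ᵥ fun i ↦ v (p.1, i)) p.2 := by
  simp only [Matrix.mulVec, dotProduct, piBlockDiag_apply]
  rw [Fintype.sum_prod_type, Finset.sum_eq_single p.1]
  · simp
  · intro l _ hl
    simp [Ne.symm hl]
  · intro h; exact absurd (Finset.mem_univ _) h

omit [DecidableEq ι] in
/-- The diagonal blocks of a product of block-diagonal matrices. [cite: GreenGriffithsKerr2012, §III.B (i) (p. 72)] -/
theorem piDiagBlock_mul_of_offDiag_eq_zero [NonUnitalNonAssocSemiring R] {M N : Matrix (Fin n × ι) (Fin n × ι) R}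
    (hM : ∀ p q : Fin n × ι, p.1 ≠ q.1 → M p q = 0) (hN : ∀ p q : Fin n × ι, p.1 ≠ q.1 → N p q = 0) (k : Fin n) :
    piDiagBlock (M * N) k = piDiagBlock M k * piDiagBlock N k := by
  have h := piBlockDiag_mul (piDiagBlock M) (piDiagBlock N)
  rw [piBlockDiag_piDiagBlock_of_offDiag_eq_zero hM, piBlockDiag_piDiagBlock_of_offDiag_eq_zero hN] at h
  rw [h, piDiagBlock_piBlockDiag]

/-- **The block-diagonal embedding `(A₀, …, A_{n−1}) ↦ diag(Aₖ)` of `∏ₖ SL(Vₖ, ℝ)` into `SL(⊕ₖ Vₖ, ℝ)`** —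
GGK's `M_{φ₁} × ⋯ × M_{φ_n} ⊆ GL(V_{φ₁} ⊕ ⋯ ⊕ V_{φ_n})` on real points, for the `n`-fold product torus
`piPeriod`. [cite: GreenGriffithsKerr2012, §III.B (i) (p. 72)] -/
def piBlockDiagSL : (Fin n → SpecialLinearGroup ι ℝ) →* SpecialLinearGroup (Fin n × ι) ℝ where
  toFun A := ⟨piBlockDiag fun k ↦ (A k : Matrix ι ι ℝ), by
    rw [det_piBlockDiag, Finset.prod_eq_one fun k _ ↦ (A k).2]⟩
  map_one' := Subtype.ext (by simp)
  map_mul' A B := Subtype.ext (by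
    change piBlockDiag (fun k ↦ ((A k : Matrix ι ι ℝ) * (B k : Matrix ι ι ℝ))) =
      piBlockDiag (fun k ↦ (A k : Matrix ι ι ℝ)) * piBlockDiag fun k ↦ (B k : Matrix ι ι ℝ)
    rw [piBlockDiag_mul])

/-- The matrix of `piBlockDiagSL A` is `diag(Aₖ)`. [cite: GreenGriffithsKerr2012, §III.B (i) (p. 72)] -/
@[simp] theorem coe_piBlockDiagSL (A : Fin n → SpecialLinearGroup ι ℝ) :
    (piBlockDiagSL A : Matrix (Fin n × ι) (Fin n × ι) ℝ) = piBlockDiag fun k ↦ (A k : Matrix ι ι ℝ) := rfl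

/-- The block-diagonal embedding is injective. [cite: GreenGriffithsKerr2012, §III.B (i) (p. 72)] -/
theorem piBlockDiagSL_injective : Function.Injective (piBlockDiagSL : (Fin n → SpecialLinearGroup ι ℝ) → _) := by
  intro A B h
  have h' := congrArg (fun M : SpecialLinearGroup (Fin n × ι) ℝ ↦ (M : Matrix (Fin n × ι) (Fin n × ι) ℝ)) h
  simp only [coe_piBlockDiagSL] at h'
  exact funext fun k ↦ Subtype.ext (congrFun (piBlockDiag_injective h') k)

end PiBlockDiag

/-! ### `J` and `h(S¹)` of the product torus `∏ₖ Xₖ` -/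

section PiPeriod

variable {n : ℕ} {ι : Type*} [Fintype ι] [DecidableEq ι] {E : Type*} [NormedAddCommGroup E] [NormedSpace ℂ E]
  (Φ : Fin n → ((ι → ℝ) ≃L[ℝ] E))

omit [DecidableEq ι] in
/-- The inverse period map of the product acts factor by factor. [cite: Lange2023AbelianVarietiesComplex, §1.1.2 (products), p. 21] -/
theorem piPeriod_symm_apply (w : Fin n → E) (p : Fin n × ι) :
    (piPeriod Φ).symm w p = (Φ p.1).symm (w p.1) p.2 := by
  set v : Fin n × ι → ℝ := fun p ↦ (Φ p.1).symm (w p.1) p.2 with hv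
  have h : piPeriod Φ v = w := by
    funext k
    rw [piPeriod_apply]
    exact (Φ k).apply_symm_apply (w k)
  have := (piPeriod Φ).symm_apply_eq.2 h.symm
  rw [this]

/-- **The complex structure of `∏ₖ Xₖ` is block-diagonal: `J = diag(J₀, …, J_{n−1})`.**
[cite: Lange2023AbelianVarietiesComplex, §1.1.2 (products), p. 21] -/
theorem jMatrix_piPeriod : jMatrix (piPeriod Φ) = piBlockDiag fun k ↦ jMatrix (Φ k) := by
  refine Matrix.toLin'.injective (LinearMap.ext fun v ↦ ?_)
  funext p
  rw [Matrix.toLin'_apply, Matrix.toLin'_apply, jMatrix_mulVec, latticeJ_apply, piPeriod_symm_apply,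
    piBlockDiag_mulVec, jMatrix_mulVec, latticeJ_apply, Pi.smul_apply, piPeriod_apply]

/-- **`h(e^{iθ}) = diag(h₀(e^{iθ}), …, h_{n−1}(e^{iθ}))`** for the product torus (`H₁(∏ Xₖ) = ⊕ H₁(Xₖ)` is the
direct sum of the Hodge structures `φₖ`). [cite: GreenGriffithsKerr2012, §III.B (i) (p. 72: "`M_{φ₁+φ₂}` refers to the Mumford–Tate group of `V_{φ₁} ⊕ V_{φ₂}`")] -/
theorem hodgeCircle_piPeriod (θ : ℝ) : hodgeCircle (piPeriod Φ) θ = piBlockDiag fun k ↦ hodgeCircle (Φ k) θ := by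
  have h : (fun k ↦ hodgeCircle (Φ k) θ) =
      Real.cos θ • (fun _ : Fin n ↦ (1 : Matrix ι ι ℝ)) + Real.sin θ • fun k ↦ jMatrix (Φ k) := by
    funext k; rfl
  rw [hodgeCircle, jMatrix_piPeriod, h, piBlockDiag_add, piBlockDiag_smul, piBlockDiag_smul, piBlockDiag_one]

/-- `h(e^{iθ})` of the product as an element of `SL`: `piBlockDiagSL (hₖ(e^{iθ}))ₖ`. [cite: GreenGriffithsKerr2012, §III.B (i) (p. 72)] -/
theorem hodgeCircleSL_piPeriod (θ : ℝ) :
    hodgeCircleSL (piPeriod Φ) θ = piBlockDiagSL fun k ↦ hodgeCircleSL (Φ k) θ :=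
  Subtype.ext (hodgeCircle_piPeriod Φ θ)

end PiPeriod

/-! ### Equation families for `Gₖ ⊆ GL(Vₖ)` imposed on the `k`-th block, and `Hg(∏ Xₖ) ⊆ ∏ Hg(Xₖ)` -/

section PiEquations

variable {n : ℕ} {ι : Type*}

/-- The off-diagonal-block equations `x_{(k,i),(l,j)} = 0` (`k ≠ l`): the block-diagonal matrices.
[cite: GreenGriffithsKerr2012, §III.B (i) (p. 72)] -/
def offDiagEqsPi (n : ℕ) (ι : Type*) : Set (MvPolynomial ((Fin n × ι) × (Fin n × ι)) ℚ) :=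
  (fun pq : (Fin n × ι) × (Fin n × ι) ↦ MvPolynomial.X pq) '' {pq | pq.1.1 ≠ pq.2.1}

/-- A family `P` of equations in `ι × ι` variables, imposed on the `k`-th diagonal block.
[cite: GreenGriffithsKerr2012, §III.B (i) (p. 72)] -/
def liftEqsPi (k : Fin n) (P : Set (MvPolynomial (ι × ι) ℚ)) : Set (MvPolynomial ((Fin n × ι) × (Fin n × ι)) ℚ) :=
  MvPolynomial.rename (fun ij : ι × ι ↦ ((k, ij.1), (k, ij.2))) '' P

/-- **The equations of `GL(V₀) × ⋯ × Gₖ × ⋯ × GL(V_{n−1}) ⊆ GL(⊕ Vₗ)`**: block-diagonal, with the `k`-th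
diagonal block in `Gₖ = V(P)`. [cite: GreenGriffithsKerr2012, §III.B (i) (p. 72)] -/
def piEqs (k : Fin n) (P : Set (MvPolynomial (ι × ι) ℚ)) : Set (MvPolynomial ((Fin n × ι) × (Fin n × ι)) ℚ) :=
  offDiagEqsPi n ι ∪ liftEqsPi k P

variable {R : Type*} [CommRing R] [Algebra ℚ R]

/-- The zero locus of the off-diagonal equations: the off-diagonal blocks vanish. [cite: GreenGriffithsKerr2012, §III.B (i) (p. 72)] -/
theorem mem_ratZeroLocus_offDiagEqsPi_iff (M : Matrix (Fin n × ι) (Fin n × ι) R) :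
    M ∈ ratZeroLocus R (offDiagEqsPi n ι) ↔ ∀ p q : Fin n × ι, p.1 ≠ q.1 → M p q = 0 := by
  constructor
  · intro h p q hpq
    have h' := h _ ⟨(p, q), hpq, rfl⟩
    simpa using h'
  · rintro h _ ⟨⟨p, q⟩, hpq, rfl⟩
    change evalMat M (MvPolynomial.X (p, q)) = 0
    rw [evalMat_X]
    exact h p q hpq

/-- Evaluating a lifted equation at `M` evaluates it at the `k`-th diagonal block. [cite: GreenGriffithsKerr2012, §III.B (i) (p. 72)] -/
theorem evalMat_rename_block (M : Matrix (Fin n × ι) (Fin n × ι) R) (k : Fin n) (f : MvPolynomial (ι × ι) ℚ) :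
    evalMat M (MvPolynomial.rename (fun ij : ι × ι ↦ ((k, ij.1), (k, ij.2))) f) = evalMat (piDiagBlock M k) f := by
  rw [evalMat, evalMat, MvPolynomial.aeval_rename]
  rfl

/-- The zero locus of `liftEqsPi k P`: the `k`-th diagonal block lies in `V(P)`. [cite: GreenGriffithsKerr2012, §III.B (i) (p. 72)] -/
theorem mem_ratZeroLocus_liftEqsPi_iff (k : Fin n) (P : Set (MvPolynomial (ι × ι) ℚ))
    (M : Matrix (Fin n × ι) (Fin n × ι) R) :
    M ∈ ratZeroLocus R (liftEqsPi k P) ↔ piDiagBlock M k ∈ ratZeroLocus R P := by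
  simp only [mem_ratZeroLocus_iff, liftEqsPi, Set.forall_mem_image, evalMat_rename_block]

/-- **The zero locus of `piEqs k P`**: `M = diag(M₀, …, M_{n−1})` with `Mₖ ∈ V(P)`. [cite: GreenGriffithsKerr2012, §III.B (i) (p. 72)] -/
theorem mem_ratZeroLocus_piEqs_iff (k : Fin n) (P : Set (MvPolynomial (ι × ι) ℚ)) (M : Matrix (Fin n × ι) (Fin n × ι) R) :
    M ∈ ratZeroLocus R (piEqs k P) ↔
      (∀ p q : Fin n × ι, p.1 ≠ q.1 → M p q = 0) ∧ piDiagBlock M k ∈ ratZeroLocus R P := by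
  rw [piEqs, mem_ratZeroLocus_union_iff, mem_ratZeroLocus_offDiagEqsPi_iff, mem_ratZeroLocus_liftEqsPi_iff]

/-- `diag(Mₗ)` satisfies `piEqs k P` iff `Mₖ ∈ V(P)`. [cite: GreenGriffithsKerr2012, §III.B (i) (p. 72)] -/
theorem piBlockDiag_mem_ratZeroLocus_piEqs_iff (k : Fin n) (P : Set (MvPolynomial (ι × ι) ℚ))
    (M : Fin n → Matrix ι ι R) : piBlockDiag M ∈ ratZeroLocus R (piEqs k P) ↔ M k ∈ ratZeroLocus R P := by
  rw [mem_ratZeroLocus_piEqs_iff, piDiagBlock_piBlockDiag]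
  exact ⟨fun h ↦ h.2, fun h ↦ ⟨fun p q hpq ↦ by rw [piBlockDiag_apply, if_neg hpq], h⟩⟩

variable [Fintype ι] [DecidableEq ι]

/-- The diagonal blocks of an invertible block-diagonal matrix are invertible. [folklore] -/
private theorem isUnit_det_piDiagBlock {M : Matrix (Fin n × ι) (Fin n × ι) ℂ}
    (hoff : ∀ p q : Fin n × ι, p.1 ≠ q.1 → M p q = 0) (hM : IsUnit M.det) (k : Fin n) :
    IsUnit (piDiagBlock M k).det := by
  rw [← piBlockDiag_piDiagBlock_of_offDiag_eq_zero hoff, det_piBlockDiag] at hM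
  exact IsUnit.prod_univ_iff.1 hM k

/-- The inverse of an invertible block-diagonal matrix is block-diagonal with the inverse blocks. [folklore] -/
private theorem inv_eq_piBlockDiag_inv {M : Matrix (Fin n × ι) (Fin n × ι) ℂ}
    (hoff : ∀ p q : Fin n × ι, p.1 ≠ q.1 → M p q = 0) (hM : IsUnit M.det) :
    M⁻¹ = piBlockDiag fun k ↦ (piDiagBlock M k)⁻¹ := by
  have hk := isUnit_det_piDiagBlock hoff hM
  refine Matrix.inv_eq_left_inv ?_
  have hMeq := piBlockDiag_piDiagBlock_of_offDiag_eq_zero hoff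
  have h1 : (fun k ↦ (piDiagBlock M k)⁻¹ * piDiagBlock M k) = fun _ ↦ (1 : Matrix ι ι ℂ) :=
    funext fun k ↦ Matrix.nonsing_inv_mul _ (hk k)
  calc piBlockDiag (fun k ↦ (piDiagBlock M k)⁻¹) * M
      = piBlockDiag (fun k ↦ (piDiagBlock M k)⁻¹) * piBlockDiag (piDiagBlock M) := by rw [hMeq]
    _ = piBlockDiag fun k ↦ (piDiagBlock M k)⁻¹ * piDiagBlock M k := piBlockDiag_mul _ _
    _ = 1 := by rw [h1, piBlockDiag_one]

/-- **`GL(V₀) × ⋯ × Gₖ × ⋯ × GL(V_{n−1})` is an algebraic `ℚ`-subgroup of `GL(⊕ Vₗ)`** when `Gₖ = V(P)` is an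
algebraic `ℚ`-subgroup of `GL(Vₖ)`: block-diagonal invertible complex matrices with `k`-th block in `V(P)` form
a subgroup. [cite: GreenGriffithsKerr2012, §III.B (i) (p. 72)] -/
theorem isRatAlgSubgroupEqs_piEqs {P : Set (MvPolynomial (ι × ι) ℚ)} (hP : IsRatAlgSubgroupEqs P) (k : Fin n) :
    IsRatAlgSubgroupEqs (piEqs (ι := ι) k P) := by
  refine ⟨?_, fun M N hM hN hMP hNP ↦ ?_, fun M hM hMP ↦ ?_⟩
  · rw [← piBlockDiag_one, piBlockDiag_mem_ratZeroLocus_piEqs_iff]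
    exact hP.1
  · obtain ⟨hMoff, hMk⟩ := (mem_ratZeroLocus_piEqs_iff k P M).1 hMP
    obtain ⟨hNoff, hNk⟩ := (mem_ratZeroLocus_piEqs_iff k P N).1 hNP
    have hMu := isUnit_det_piDiagBlock hMoff hM k
    have hNu := isUnit_det_piDiagBlock hNoff hN k
    rw [← piBlockDiag_piDiagBlock_of_offDiag_eq_zero hMoff, ← piBlockDiag_piDiagBlock_of_offDiag_eq_zero hNoff,
      piBlockDiag_mul, piBlockDiag_mem_ratZeroLocus_piEqs_iff]
    exact hP.2.1 _ _ hMu hNu hMk hNk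
  · obtain ⟨hMoff, hMk⟩ := (mem_ratZeroLocus_piEqs_iff k P M).1 hMP
    have hMu := isUnit_det_piDiagBlock hMoff hM k
    rw [inv_eq_piBlockDiag_inv hMoff hM, piBlockDiag_mem_ratZeroLocus_piEqs_iff]
    exact hP.2.2 _ hMu hMk

variable {E : Type*} [NormedAddCommGroup E] [NormedSpace ℂ E] (Φ : Fin n → ((ι → ℝ) ≃L[ℝ] E))

/-- `h(S¹)` of the product satisfies `piEqs k P` as soon as `hₖ(S¹) ⊆ V(P)`. [cite: GreenGriffithsKerr2012, §III.B (i) (p. 72)] -/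
theorem hodgeCircle_piPeriod_mem_ratZeroLocus_piEqs {k : Fin n} {P : Set (MvPolynomial (ι × ι) ℚ)}
    (hh : ∀ θ : ℝ, hodgeCircle (Φ k) θ ∈ ratZeroLocus ℝ P) (θ : ℝ) :
    hodgeCircle (piPeriod Φ) θ ∈ ratZeroLocus ℝ (piEqs k P) := by
  rw [hodgeCircle_piPeriod, piBlockDiag_mem_ratZeroLocus_piEqs_iff]
  exact hh θ

/-- Minimality of `Hg(∏ Xₗ)` against the lifted families: every element of `Hg(∏ Xₗ)(ℝ)` satisfies `piEqs k P`
for every subgroup family `P ∋ hₖ(S¹)`. [cite: GreenGriffithsKerr2012, §III.B (i) (p. 72)] -/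
theorem mem_ratZeroLocus_piEqs_of_mem_hodgeGroup_pi {k : Fin n} {P : Set (MvPolynomial (ι × ι) ℚ)}
    (hP : IsRatAlgSubgroupEqs P) (hh : ∀ θ : ℝ, hodgeCircle (Φ k) θ ∈ ratZeroLocus ℝ P)
    {M : SpecialLinearGroup (Fin n × ι) ℝ} (hM : M ∈ hodgeGroup (piPeriod Φ)) :
    M.1 ∈ ratZeroLocus ℝ (piEqs k P) :=
  hM _ (isRatAlgSubgroupEqs_piEqs hP k) (hodgeCircle_piPeriod_mem_ratZeroLocus_piEqs Φ hh)

/-- **An element of `Hg(∏ Xₗ)(ℝ)` is block-diagonal** (for `n ≥ 1`; for `n = 0` the matrix is empty).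
[cite: GreenGriffithsKerr2012, §III.B (i) (p. 72)] -/
theorem offDiag_eq_zero_of_mem_hodgeGroup_pi {M : SpecialLinearGroup (Fin n × ι) ℝ}
    (hM : M ∈ hodgeGroup (piPeriod Φ)) (p q : Fin n × ι) (hpq : p.1 ≠ q.1) : M.1 p q = 0 :=
  ((mem_ratZeroLocus_piEqs_iff p.1 _ _).1 (mem_ratZeroLocus_piEqs_of_mem_hodgeGroup_pi Φ (k := p.1)
    isRatAlgSubgroupEqs_empty (fun _ _ h ↦ h.elim) hM)).1 p q hpq

/-- The diagonal blocks of an element of `Hg(∏ Xₗ)(ℝ)` have determinant `1`. [cite: GreenGriffithsKerr2012, §III.B (i) (p. 72)] -/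
theorem det_piDiagBlock_of_mem_hodgeGroup_pi {M : SpecialLinearGroup (Fin n × ι) ℝ}
    (hM : M ∈ hodgeGroup (piPeriod Φ)) (k : Fin n) : (piDiagBlock M.1 k).det = 1 :=
  (mem_ratZeroLocus_slEqs_iff _).1 ((mem_ratZeroLocus_piEqs_iff k _ _).1
    (mem_ratZeroLocus_piEqs_of_mem_hodgeGroup_pi Φ isRatAlgSubgroupEqs_slEqs
      (hodgeCircle_mem_ratZeroLocus_slEqs (Φ k)) hM)).2

/-- **The `k`-th diagonal block of an element of `Hg(∏ Xₗ)(ℝ)` lies in `Hg(Xₖ)(ℝ)`** (lift every family of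
`ℚ`-subgroup equations satisfied by `hₖ(S¹)` to the product). [cite: GreenGriffithsKerr2012, §III.B (i) (p. 72)] -/
theorem piDiagBlock_mem_hodgeGroup {M : SpecialLinearGroup (Fin n × ι) ℝ} (hM : M ∈ hodgeGroup (piPeriod Φ))
    (k : Fin n) :
    (⟨piDiagBlock M.1 k, det_piDiagBlock_of_mem_hodgeGroup_pi Φ hM k⟩ : SpecialLinearGroup ι ℝ) ∈ hodgeGroup (Φ k) :=
  fun _ hP hh ↦ ((mem_ratZeroLocus_piEqs_iff k _ _).1 (mem_ratZeroLocus_piEqs_of_mem_hodgeGroup_pi Φ hP hh hM)).2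

/-- **GGK III.B (i) for finite products: `Hg(X₀ × ⋯ × X_{n−1}) ⊆ Hg(X₀) × ⋯ × Hg(X_{n−1})`** (real points,
block-diagonally in `SL(⊕ₖ H₁(Xₖ, ℝ))`), for any family of complex tori `Xₖ = E/Φₖ(ℤ^ι)`; Imai §1: "for any
complex tori `A₁, A₂`, `Hg(A₁ × A₂) ⊂ Hg(A₁) × Hg(A₂)`". [cite: GreenGriffithsKerr2012, §III.B (i) (p. 72)]
[cite: Imai1976HodgeGroups, §1 (p. 367)] -/
theorem hodgeGroup_pi_le :
    hodgeGroup (piPeriod Φ) ≤ (Subgroup.pi Set.univ fun k ↦ hodgeGroup (Φ k)).map piBlockDiagSL := by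
  intro M hM
  refine Subgroup.mem_map.2 ⟨fun k ↦ ⟨piDiagBlock M.1 k, det_piDiagBlock_of_mem_hodgeGroup_pi Φ hM k⟩,
    fun k _ ↦ piDiagBlock_mem_hodgeGroup Φ hM k, Subtype.ext ?_⟩
  rw [coe_piBlockDiagSL]
  exact piBlockDiag_piDiagBlock_of_offDiag_eq_zero (offDiag_eq_zero_of_mem_hodgeGroup_pi Φ hM)

/-- GGK III.B (i) on elements: every `M ∈ Hg(∏ Xₖ)(ℝ)` is `diag(A₀, …, A_{n−1})` with `Aₖ ∈ Hg(Xₖ)(ℝ)`.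
[cite: GreenGriffithsKerr2012, §III.B (i) (p. 72)] -/
theorem exists_eq_piBlockDiagSL_of_mem_hodgeGroup_pi {M : SpecialLinearGroup (Fin n × ι) ℝ}
    (hM : M ∈ hodgeGroup (piPeriod Φ)) :
    ∃ A : Fin n → SpecialLinearGroup ι ℝ, (∀ k, A k ∈ hodgeGroup (Φ k)) ∧ M = piBlockDiagSL A := by
  obtain ⟨A, hA, h⟩ := Subgroup.mem_map.1 (hodgeGroup_pi_le Φ hM)
  exact ⟨A, fun k ↦ hA k (Set.mem_univ k), h.symm⟩

end PiEquations

/-! ## §2 The Galois step: conjugating the rational-parameter points of `h(S¹)` (Imai p. 368) -/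

section GaloisStep

open Literature.FieldTheory.Kummer

variable {n : ℕ}

/-- The rational matrix `N(p, q) = (p/2 − p, 1; −q, p/2)` of multiplication by `τ + p/2 = i · Im τ` on
`ℚ(τ)`, `τ² + pτ + q = 0` — realified it is `Im τ · J` (`map_ratCast_imMatrix`).
[cite: Imai1976HodgeGroups, §2 Proposition (proof, first case, p. 368: "taking `1, √-dᵢ` as a `Q`-basis of `Kᵢ`, we can represent `φᵢ(z)` … as …")] -/
def imRatMatrix (p q : ℚ) : Matrix (Fin 2) (Fin 2) ℚ := !![p / 2 - 1 * p, 1; -1 * q, p / 2]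

/-- **The polynomial matrix `𝓜(u) = diag(a·1 + (b/cₖ) uₖ Nₖ)`** with entries in `ℚ[u₀, …, u_{n−1}]`
(`cₖ = qₖ − pₖ²/4 = (Im τₖ)²`, `Nₖ = N(pₖ, qₖ)`): its value at `u = (Im τₖ)ₖ` is the point `h(e^{iθ})`,
`e^{iθ} = a + bi`, of `h(S¹)`, and its values at the Galois conjugates `(εₖ Im τₖ)ₖ` are the twisted points
`diag(ρₖ(a + εₖ b i))`. [cite: Imai1976HodgeGroups, §2 Proposition (proof, first case, p. 368: "we can represent `φᵢ(z)` (`z = a + b√-1`, `|z| = 1`, `a, b ∈ Q`) as …")] -/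
def cmPolyMatrix (a b : ℚ) (p q : Fin n → ℚ) : Matrix (Fin n × Fin 2) (Fin n × Fin 2) (MvPolynomial (Fin n) ℚ) :=
  piBlockDiag fun k ↦ (MvPolynomial.C a : MvPolynomial (Fin n) ℚ) • (1 : Matrix (Fin 2) (Fin 2) (MvPolynomial (Fin n) ℚ)) +
    (MvPolynomial.C (b / (q k - p k ^ 2 / 4)) * MvPolynomial.X k : MvPolynomial (Fin n) ℚ) •
      (imRatMatrix (p k) (q k)).map (MvPolynomial.C : ℚ → MvPolynomial (Fin n) ℚ)

/-- **Evaluating `𝓜(u)` at a real point `u = s`**: `𝓜(s) = diag(a·1 + ((b/cₖ) sₖ) Nₖ)`.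
[cite: Imai1976HodgeGroups, §2 Proposition (proof, first case, p. 368)] -/
theorem cmPolyMatrix_map_aeval (a b : ℚ) (p q : Fin n → ℚ) (s : Fin n → ℝ) :
    (cmPolyMatrix a b p q).map (MvPolynomial.aeval s) =
      piBlockDiag fun k ↦ (a : ℝ) • (1 : Matrix (Fin 2) (Fin 2) ℝ) +
        (((b / (q k - p k ^ 2 / 4) : ℚ) : ℝ) * s k) • (imRatMatrix (p k) (q k)).map (Rat.cast : ℚ → ℝ) := by
  rw [cmPolyMatrix, piBlockDiag_map _ (map_zero _)]
  congr 1
  funext k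
  ext i j
  simp only [Matrix.map_apply, Matrix.add_apply, Matrix.smul_apply, Matrix.one_apply, smul_eq_mul, map_add,
    map_mul, mul_ite, mul_one, mul_zero, MvPolynomial.aeval_C, MvPolynomial.aeval_X, eq_ratCast]
  split_ifs <;> simp [eq_ratCast]

/-- `f(𝓜(s)) = g(s)` for `g = f(𝓜(u)) ∈ ℚ[u]`: evaluation of a `ℚ`-polynomial in the matrix entries at the
real point `𝓜(s)` is the value at `s` of the composite polynomial. [cite: Imai1976HodgeGroups, §2 Proposition (proof, first case, p. 368: "Putting the point … in `(*)`")] -/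
theorem evalMat_cmPolyMatrix_map_aeval (a b : ℚ) (p q : Fin n → ℚ) (s : Fin n → ℝ)
    (f : MvPolynomial ((Fin n × Fin 2) × (Fin n × Fin 2)) ℚ) :
    evalMat ((cmPolyMatrix a b p q).map (MvPolynomial.aeval s)) f =
      MvPolynomial.aeval s (evalMat (cmPolyMatrix a b p q) f) :=
  evalMat_map (MvPolynomial.aeval s) _ f

variable {ι : Type*} [Fintype ι] [DecidableEq ι] (Ψ : (ι → ℝ) ≃L[ℝ] ℂ)

/-- `α · 1 + β · J = ρ_r(α + βi)` for real `α, β`. [cite: Lange2023AbelianVarietiesComplex, §7.1.1 Prop. 7.1.1] -/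
theorem smul_one_add_smul_jMatrix_eq_mulMatrix (α β : ℝ) :
    α • (1 : Matrix ι ι ℝ) + β • jMatrix Ψ = mulMatrix Ψ ((α : ℂ) + (β : ℂ) * I) := by
  have hre : ((α : ℂ) + (β : ℂ) * I).re = α := by simp
  have him : ((α : ℂ) + (β : ℂ) * I).im = β := by simp
  rw [mulMatrix, hre, him]

variable {τ : Fin n → ℂ} (hτ : ∀ k, (τ k).im ≠ 0)

include hτ in
/-- `cₖ = qₖ − pₖ²/4 = (Im τₖ)² ≠ 0`. [cite: Imai1976HodgeGroups, §2 Proposition (proof, first case: `Kᵢ = Q(√-dᵢ)`)] -/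
theorem im_sq_ratCast_ne_zero {p q : Fin n → ℚ} (hq : ∀ k, τ k ^ 2 + p k * τ k + q k = 0) (k : Fin n) :
    (q k - p k ^ 2 / 4 : ℚ) ≠ 0 := by
  intro h
  have h1 := im_sq_eq_of_quadratic (hτ k) (hq k)
  have h2 : ((q k - p k ^ 2 / 4 : ℚ) : ℝ) = 0 := by rw [h, Rat.cast_zero]
  push_cast at h2
  rw [← h1] at h2
  exact hτ k (pow_eq_zero_iff (n := 2) two_ne_zero |>.1 h2)

include hτ in
/-- `(Im τₖ)² = cₖ` read as the Kummer datum `yₖ² = algebraMap ℚ ℝ cₖ`. [cite: Imai1976HodgeGroups, §2 Proposition (proof, first case: `Kᵢ = Q(√-dᵢ)`)] -/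
theorem im_sq_eq_algebraMap {p q : Fin n → ℚ} (hq : ∀ k, τ k ^ 2 + p k * τ k + q k = 0) (k : Fin n) :
    (τ k).im ^ 2 = algebraMap ℚ ℝ (q k - p k ^ 2 / 4) := by
  rw [im_sq_eq_of_quadratic (hτ k) (hq k), eq_ratCast]
  push_cast
  ring

/-- **The blocks of `𝓜` at (twisted) imaginary parts are the matrices `ρₖ(a + t b i)`**: for real `t`,
`a·1 + ((b/cₖ)(t · Im τₖ)) Nₖ = ρ_r(a + (tb) i)` on `H₁(E_{τₖ}, ℝ)` (`Nₖ = Im τₖ · Jₖ`, `(Im τₖ)² = cₖ`).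
[cite: Imai1976HodgeGroups, §2 Proposition (proof, first case, p. 368: "`φᵢ(z)^σ = φᵢ(z)^{εᵢ}` where `εᵢ = ±1`")] -/
theorem cmPolyMatrix_block_eq_mulMatrix {p q : Fin n → ℚ} (hq : ∀ k, τ k ^ 2 + p k * τ k + q k = 0)
    (a b : ℚ) (t : ℝ) (k : Fin n) :
    (a : ℝ) • (1 : Matrix (Fin 2) (Fin 2) ℝ) +
        (((b / (q k - p k ^ 2 / 4) : ℚ) : ℝ) * (t * (τ k).im)) • (imRatMatrix (p k) (q k)).map (Rat.cast : ℚ → ℝ) =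
      mulMatrix (ellipticPeriod (hτ k)) ((a : ℂ) + ((t * b : ℝ) : ℂ) * I) := by
  have hN : (imRatMatrix (p k) (q k)).map (Rat.cast : ℚ → ℝ) = (τ k).im • jMatrix (ellipticPeriod (hτ k)) :=
    map_ratCast_imMatrix (hτ k) (hq k)
  have hc : ((q k - p k ^ 2 / 4 : ℚ) : ℝ) ≠ 0 := by exact_mod_cast im_sq_ratCast_ne_zero hτ hq k
  have hy2 : (τ k).im ^ 2 = ((q k - p k ^ 2 / 4 : ℚ) : ℝ) := by
    rw [im_sq_eq_of_quadratic (hτ k) (hq k)]; push_cast; ring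
  have hcoef : ((b / (q k - p k ^ 2 / 4) : ℚ) : ℝ) * (t * (τ k).im) * (τ k).im = t * b := by
    have h1 : ((b / (q k - p k ^ 2 / 4) : ℚ) : ℝ) = (b : ℝ) / ((q k - p k ^ 2 / 4 : ℚ) : ℝ) := by
      rw [Rat.cast_div]
    have hyc : (τ k).im ^ 2 / ((q k - p k ^ 2 / 4 : ℚ) : ℝ) = 1 := by rw [hy2, div_self hc]
    calc ((b / (q k - p k ^ 2 / 4) : ℚ) : ℝ) * (t * (τ k).im) * (τ k).im
        = t * b * ((τ k).im ^ 2 / ((q k - p k ^ 2 / 4 : ℚ) : ℝ)) := by rw [h1]; ring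
      _ = t * b := by rw [hyc, mul_one]
  rw [hN, smul_smul, hcoef, show ((a : ℚ) : ℂ) = ((a : ℝ) : ℂ) from (Complex.ofReal_ratCast a).symm,
    ← smul_one_add_smul_jMatrix_eq_mulMatrix]

/-- **`𝓜` evaluated at the (twisted) imaginary parts**: `𝓜((tₖ Im τₖ)ₖ) = diag(ρₖ(a + tₖ b i))`.
[cite: Imai1976HodgeGroups, §2 Proposition (proof, first case, p. 368)] -/
theorem cmPolyMatrix_map_aeval_mul_im {p q : Fin n → ℚ} (hq : ∀ k, τ k ^ 2 + p k * τ k + q k = 0)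
    (a b : ℚ) (t : Fin n → ℝ) :
    (cmPolyMatrix a b p q).map (MvPolynomial.aeval fun k ↦ t k * (τ k).im) =
      piBlockDiag fun k ↦ mulMatrix (ellipticPeriod (hτ k)) ((a : ℂ) + ((t k * b : ℝ) : ℂ) * I) := by
  rw [cmPolyMatrix_map_aeval]
  congr 1
  funext k
  exact cmPolyMatrix_block_eq_mulMatrix hτ hq a b (t k) k

variable (τ) in
/-- **The sign `εₖ(σ) = σ(Im τₖ)/Im τₖ = ±1`** of an automorphism `σ` of the multiquadratic field
`ℚ(Im τ₀, …, Im τ_{n−1}) = ℚ(√c₀, …, √c_{n−1}) ⊂ ℝ` on the `k`-th generator (the quadratic Kummer sign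
character of `Literature/FieldTheory/Kummer/QuadraticKummerSigns.lean`) — Imai's `εᵢ`:
"`φᵢ(z)^σ = φᵢ(z)^{εᵢ}` where `εᵢ = ±1`". [cite: Imai1976HodgeGroups, §2 Proposition (proof, first case, p. 368)] -/
def cmGalSign (σ : kummerField ℚ (fun k ↦ (τ k).im) ≃ₐ[ℚ] kummerField ℚ (fun k ↦ (τ k).im)) (k : Fin n) : ℝ :=
  (σ (gen ℚ (fun k ↦ (τ k).im) k) : ℝ) / (τ k).im

include hτ in
/-- `εₖ(σ) = 1` or `εₖ(σ) = −1`. [cite: Imai1976HodgeGroups, §2 Proposition (proof, first case, p. 368: "`εᵢ = ±1`")] -/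
theorem cmGalSign_eq_one_or {p q : Fin n → ℚ} (hq : ∀ k, τ k ^ 2 + p k * τ k + q k = 0)
    (σ : kummerField ℚ (fun k ↦ (τ k).im) ≃ₐ[ℚ] kummerField ℚ (fun k ↦ (τ k).im)) (k : Fin n) :
    cmGalSign τ σ k = 1 ∨ cmGalSign τ σ k = -1 :=
  algEquiv_gen_div_eq_one_or Rat.isPrimitiveRoot_neg_one_two _ (fun k ↦ q k - p k ^ 2 / 4)
    (im_sq_ratCast_ne_zero hτ hq) (im_sq_eq_algebraMap hτ hq) σ k

include hτ in
/-- **The Galois step (Imai p. 368: "As `H` is defined over `Q`, `h^σ ∈ H` […] `φᵢ(z)^σ = φᵢ(z)^{εᵢ}`").**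
Let `G = V(P)` be an algebraic `ℚ`-group of `H₁(∏ E_{τₖ})` containing `h(S¹)`, and `e^{iθ} = a + bi` a RATIONAL
point of `S¹` (`a, b ∈ ℚ`). Then for every automorphism `σ` of `ℚ(Im τ₀, …, Im τ_{n−1})` the twisted point
`diag(ρₖ(a + εₖ(σ) b i)) ∈ G(ℝ)`: the polynomial `f(𝓜(u)) ∈ ℚ[u]` (`f ∈ P`) vanishes at `u = (Im τₖ)ₖ`
(where `𝓜 = h(e^{iθ}) ∈ G`), hence at the Galois conjugate `(εₖ(σ) Im τₖ)ₖ`.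
[cite: Imai1976HodgeGroups, §2 Proposition (proof, first case, p. 368)] -/
theorem piBlockDiag_mulMatrix_sign_mem_ratZeroLocus {p q : Fin n → ℚ} (hq : ∀ k, τ k ^ 2 + p k * τ k + q k = 0)
    {P : Set (MvPolynomial ((Fin n × Fin 2) × (Fin n × Fin 2)) ℚ)}
    (hh : ∀ θ : ℝ, hodgeCircle (piPeriod fun k ↦ ellipticPeriod (hτ k)) θ ∈ ratZeroLocus ℝ P)
    {a b : ℚ} (hab : ∃ θ : ℝ, Complex.exp (θ * I) = (a : ℂ) + (b : ℂ) * I)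
    (σ : kummerField ℚ (fun k ↦ (τ k).im) ≃ₐ[ℚ] kummerField ℚ (fun k ↦ (τ k).im)) :
    piBlockDiag (fun k ↦ mulMatrix (ellipticPeriod (hτ k)) ((a : ℂ) + ((cmGalSign τ σ k * b : ℝ) : ℂ) * I)) ∈
      ratZeroLocus ℝ P := by
  obtain ⟨θ, hθ⟩ := hab
  have hc := im_sq_ratCast_ne_zero hτ hq
  have hy := im_sq_eq_algebraMap hτ hq
  -- `h(e^{iθ}) = 𝓜(y)`, `y = (Im τₖ)ₖ`
  have h1 : hodgeCircle (piPeriod fun k ↦ ellipticPeriod (hτ k)) θ =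
      (cmPolyMatrix a b p q).map (MvPolynomial.aeval fun k ↦ (1 : ℝ) * (τ k).im) := by
    rw [cmPolyMatrix_map_aeval_mul_im hτ hq, hodgeCircle_piPeriod]
    congr 1
    funext k
    rw [← mulMatrix_exp_mul_I, hθ]
    congr 1
    push_cast
    ring
  intro f hf
  -- `g = f(𝓜(u))` vanishes at `y`
  have h2 : MvPolynomial.aeval (fun k ↦ (τ k).im) (evalMat (cmPolyMatrix a b p q) f) = 0 := by
    have hy1 : (fun k ↦ (1 : ℝ) * (τ k).im) = fun k ↦ (τ k).im := funext fun k ↦ one_mul _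
    rw [← hy1, ← evalMat_cmPolyMatrix_map_aeval, ← h1]
    exact hh θ f hf
  -- hence at the Galois conjugate `ε(σ) y`
  have h3 : MvPolynomial.aeval (fun k ↦ cmGalSign τ σ k * (τ k).im) (evalMat (cmPolyMatrix a b p q) f) = 0 :=
    aeval_algEquiv_gen_div_mul_eq_zero (fun k ↦ (τ k).im) (fun k ↦ q k - p k ^ 2 / 4) hc hy h2 σ
  rw [← evalMat_cmPolyMatrix_map_aeval, cmPolyMatrix_map_aeval_mul_im hτ hq] at h3
  exact h3

end GaloisStep

/-! ## §3 Zariski density along the twisted complexified circles, and generation of `∏ₖ hₖ(S¹)` -/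

section Density

open Literature.FieldTheory.Kummer

variable {n : ℕ} {ι : Type*} [Fintype ι] [DecidableEq ι] (Ψ : (ι → ℝ) ≃L[ℝ] ℂ)

/-- **The twisted complexified circle** `ν_ε(u) = ½(u + u⁻¹) · 1 + ε (1/2i)(u − u⁻¹) · J` is Laurent-linear:
`ν_ε(u) = u · B_ε + u⁻¹ · C_ε`. [cite: vanGeemen1994HodgeAV, §6.4–6.7 (`G(ℂ)`)] -/
theorem twistedCurve_eq_smul_add_smul (ε u : ℂ) :
    ((u + u⁻¹) / 2) • (1 : Matrix ι ι ℂ) + (ε * ((u - u⁻¹) / (2 * I))) • (jMatrix Ψ).map Complex.ofRealHom =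
      u • (((1 : ℂ) / 2) • (1 : Matrix ι ι ℂ) + (ε / (2 * I)) • (jMatrix Ψ).map Complex.ofRealHom) +
        u⁻¹ • (((1 : ℂ) / 2) • (1 : Matrix ι ι ℂ) - (ε / (2 * I)) • (jMatrix Ψ).map Complex.ofRealHom) := by
  simp only [smul_add, smul_sub, smul_smul]
  module

/-- **On the unit circle the twisted complexified circle is `h(e^{iεθ})`** for a sign `ε = ±1`:
`ν_ε(e^{iθ}) = (cos θ · 1 + ε sin θ · J) ⊗ 1 = h(e^{iεθ}) ⊗ 1`. [cite: Lange2023AbelianVarietiesComplex, §7.2.1 (proof of Prop. 7.2.3: `h(z) = cos θ · 1 + sin θ · J`)] -/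
theorem twistedCurve_exp_eq_map_hodgeCircle {ε : ℝ} (hε : ε = 1 ∨ ε = -1) (θ : ℝ) :
    ((Complex.exp (θ * I) + (Complex.exp (θ * I))⁻¹) / 2) • (1 : Matrix ι ι ℂ) +
        ((ε : ℂ) * ((Complex.exp (θ * I) - (Complex.exp (θ * I))⁻¹) / (2 * I))) • (jMatrix Ψ).map Complex.ofRealHom =
      (hodgeCircle Ψ (ε * θ)).map Complex.ofRealHom := by
  have hu : ‖Complex.exp (θ * I)‖ = 1 := Complex.norm_exp_ofReal_mul_I θ
  have hinv : (Complex.exp (θ * I))⁻¹ = conj (Complex.exp (θ * I)) := Complex.inv_eq_conj hu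
  have h1 : (Complex.exp (θ * I) + (Complex.exp (θ * I))⁻¹) / 2 = (Real.cos θ : ℂ) := by
    rw [hinv, Complex.add_conj, Complex.exp_ofReal_mul_I_re]; push_cast; ring
  have h2 : (Complex.exp (θ * I) - (Complex.exp (θ * I))⁻¹) / (2 * I) = (Real.sin θ : ℂ) := by
    rw [hinv, Complex.sub_conj, Complex.exp_ofReal_mul_I_im]; push_cast; field_simp
  have hcs : Real.cos (ε * θ) = Real.cos θ ∧ Real.sin (ε * θ) = ε * Real.sin θ := by
    rcases hε with rfl | rfl
    · simp
    · simp [Real.cos_neg, Real.sin_neg]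
  rw [h1, h2, hodgeCircle, hcs.1, hcs.2]
  ext i j
  simp only [Matrix.add_apply, Matrix.smul_apply, Matrix.map_apply, Matrix.one_apply, smul_eq_mul,
    Complex.ofRealHom_eq_coe, mul_ite, mul_one, mul_zero]
  split_ifs <;> push_cast <;> ring

/-- For a norm-one `z` and a sign `ε = ±1`: `ρ_r(Re z + ε Im z · i) = h(e^{iεθ})` where `z = e^{iθ}`
(`ε = 1`: `z` itself; `ε = −1`: `z̄ = e^{−iθ}`). [cite: Lange2023AbelianVarietiesComplex, §7.2.1 (proof of Prop. 7.2.3)] -/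
theorem mulMatrix_re_add_sign_mul_im_eq_hodgeCircle {ε : ℝ} (hε : ε = 1 ∨ ε = -1) (θ : ℝ) :
    mulMatrix Ψ (((Complex.exp (θ * I)).re : ℂ) + ((ε * (Complex.exp (θ * I)).im : ℝ) : ℂ) * I) =
      hodgeCircle Ψ (ε * θ) := by
  rw [Complex.exp_ofReal_mul_I_re, Complex.exp_ofReal_mul_I_im, ← smul_one_add_smul_jMatrix_eq_mulMatrix,
    hodgeCircle]
  rcases hε with rfl | rfl
  · simp
  · simp [Real.cos_neg, Real.sin_neg]

variable {τ : Fin n → ℂ} (hτ : ∀ k, (τ k).im ≠ 0)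

include hτ in
/-- **Zariski density (Imai's character equations `(*)`).** Under the hypotheses of the Galois step, for every
`σ` the whole twisted circle lies in `G(ℝ)`: `diag(hₖ(e^{i εₖ(σ) θ})) ∈ G(ℝ)` for EVERY `θ ∈ ℝ` — the twisted
one-parameter group `u ↦ diag(ν_{εₖ(σ)}(u))` of complex matrices passes through the infinitely many conjugated
rational points `zₘ = (m + i)/(m − i)` (§2), hence lies in `G(ℂ)`, and on `|u| = 1` it is real.
[cite: Imai1976HodgeGroups, §2 Proposition (proof, first case, pp. 368–369)] [cite: vanGeemen1994HodgeAV, §6.4–6.7 (`G(ℂ)`)] -/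
theorem piBlockDiag_hodgeCircle_sign_mem_ratZeroLocus {p q : Fin n → ℚ} (hq : ∀ k, τ k ^ 2 + p k * τ k + q k = 0)
    {P : Set (MvPolynomial ((Fin n × Fin 2) × (Fin n × Fin 2)) ℚ)}
    (hh : ∀ θ : ℝ, hodgeCircle (piPeriod fun k ↦ ellipticPeriod (hτ k)) θ ∈ ratZeroLocus ℝ P)
    (σ : kummerField ℚ (fun k ↦ (τ k).im) ≃ₐ[ℚ] kummerField ℚ (fun k ↦ (τ k).im)) (θ : ℝ) :
    piBlockDiag (fun k ↦ hodgeCircle (ellipticPeriod (hτ k)) (cmGalSign τ σ k * θ)) ∈ ratZeroLocus ℝ P := by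
  have hI : (I : ℂ).im ≠ 0 := by simp
  have hIq : (I : ℂ) ^ 2 + ((0 : ℚ) : ℂ) * I + ((1 : ℚ) : ℂ) = 0 := by push_cast; linear_combination I_sq
  have hε := cmGalSign_eq_one_or hτ hq σ
  -- the twisted one-parameter group `u ↦ u • A₁ + u⁻¹ • A₂`
  set A₁ : Matrix (Fin n × Fin 2) (Fin n × Fin 2) ℂ := piBlockDiag fun k ↦
    ((1 : ℂ) / 2) • (1 : Matrix (Fin 2) (Fin 2) ℂ) +
      ((cmGalSign τ σ k : ℂ) / (2 * I)) • (jMatrix (ellipticPeriod (hτ k))).map Complex.ofRealHom with hA₁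
  set A₂ : Matrix (Fin n × Fin 2) (Fin n × Fin 2) ℂ := piBlockDiag fun k ↦
    ((1 : ℂ) / 2) • (1 : Matrix (Fin 2) (Fin 2) ℂ) -
      ((cmGalSign τ σ k : ℂ) / (2 * I)) • (jMatrix (ellipticPeriod (hτ k))).map Complex.ofRealHom with hA₂
  -- on `u = e^{iθ'}` it is the complexification of the twisted real circle
  have hcurve : ∀ θ' : ℝ, (0 : Matrix _ _ ℂ) + Complex.exp (θ' * I) • A₁ + (Complex.exp (θ' * I))⁻¹ • A₂ =
      (piBlockDiag fun k ↦ hodgeCircle (ellipticPeriod (hτ k)) (cmGalSign τ σ k * θ')).map Complex.ofRealHom := by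
    intro θ'
    rw [zero_add, hA₁, hA₂, ← piBlockDiag_smul, ← piBlockDiag_smul, ← piBlockDiag_add,
      piBlockDiag_map _ (map_zero _)]
    congr 1
    funext k
    simp only [Pi.add_apply, Pi.smul_apply]
    rw [← twistedCurve_eq_smul_add_smul, twistedCurve_exp_eq_map_hodgeCircle _ (hε k)]
  -- the infinitely many rational points `zₘ` of `S¹`
  set S : Set ℂ := Set.range fun m : ℕ ↦ ((m : ℂ) + I) / ((m : ℂ) + conj I) with hS
  have hSinf : S.Infinite := infinite_range_natCast_add_div hI
  have hmem : ∀ u ∈ S, u ≠ 0 → (0 : Matrix _ _ ℂ) + u • A₁ + u⁻¹ • A₂ ∈ ratZeroLocus ℂ P := by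
    rintro u ⟨m, rfl⟩ -
    beta_reduce
    have hz1 : ‖((m : ℂ) + I) / ((m : ℂ) + conj I)‖ = 1 := norm_natCast_add_div_natCast_add_conj hI m
    obtain ⟨θ', hθ'⟩ := (Complex.norm_eq_one_iff _).1 hz1
    obtain ⟨a, b, hab⟩ := (mem_span_one_tau_iff I).1 (natCast_add_div_mem_span hI hIq m)
    rw [← hθ', hcurve θ', map_ofReal_mem_ratZeroLocus_iff]
    have hgal := piBlockDiag_mulMatrix_sign_mem_ratZeroLocus hτ hq hh ⟨θ', by rw [hθ', hab]⟩ σ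
    have hre : (a : ℂ) = ((Complex.exp (θ' * I)).re : ℂ) := by
      rw [hθ', hab]; simp
    have him : ∀ k, ((cmGalSign τ σ k * b : ℝ) : ℂ) = ((cmGalSign τ σ k * (Complex.exp (θ' * I)).im : ℝ) : ℂ) := by
      intro k; rw [hθ', hab]; simp
    have hfun : (fun k ↦ mulMatrix (ellipticPeriod (hτ k)) ((a : ℂ) + ((cmGalSign τ σ k * b : ℝ) : ℂ) * I)) =
        fun k ↦ hodgeCircle (ellipticPeriod (hτ k)) (cmGalSign τ σ k * θ') := by
      funext k
      rw [hre, him k, mulMatrix_re_add_sign_mul_im_eq_hodgeCircle _ (hε k)]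
    rwa [hfun] at hgal
  have hθ0 : Complex.exp (θ * I) ≠ 0 := Complex.exp_ne_zero _
  have h := mem_ratZeroLocus_of_infinite 0 A₁ A₂ hSinf hmem hθ0
  rwa [hcurve θ, map_ofReal_mem_ratZeroLocus_iff] at h

include hτ in
/-- `hₖ(e^{i(θ₁+θ₂)}) = hₖ(e^{iθ₁}) hₖ(e^{iθ₂})` blockwise: the map `θ ↦ diag(hₖ(e^{iθₖ}))` is a homomorphism
`ℝⁿ → SL`. [cite: Lange2023AbelianVarietiesComplex, §7.1.1 Prop. 7.1.1 (`h` is a representation)] -/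
theorem piBlockDiagSL_hodgeCircleSL_add (θ₁ θ₂ : Fin n → ℝ) :
    piBlockDiagSL (fun k ↦ hodgeCircleSL (ellipticPeriod (hτ k)) (θ₁ k + θ₂ k)) =
      piBlockDiagSL (fun k ↦ hodgeCircleSL (ellipticPeriod (hτ k)) (θ₁ k)) *
        piBlockDiagSL fun k ↦ hodgeCircleSL (ellipticPeriod (hτ k)) (θ₂ k) := by
  rw [← map_mul]
  congr 1
  funext k
  exact Subtype.ext (hodgeCircle_add _ _ _)

include hτ in
/-- **Imai's non-isogeny hypothesis in Kummer form**: for pairwise non-isogenous CM curves `E_{τₖ} ≁ E_{τₗ}`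
(`k ≠ l`) the product `Im τₖ · Im τₗ` is irrational (the CM fields `ℚ(τₖ) = ℚ(√−cₖ)` are distinct, i.e.
`cₖ cₗ` is not a square). [cite: Imai1976HodgeGroups, §2 Proposition (hypothesis "non-isogenous"; proof, first case: distinct `dᵢ`)] -/
theorem im_mul_im_ne_ratCast_of_not_isIsogenous {p q : Fin n → ℚ} (hq : ∀ k, τ k ^ 2 + p k * τ k + q k = 0)
    (hiso : ∀ k l, k ≠ l → ¬ IsIsogenous (ellipticPeriod (hτ k)) (ellipticPeriod (hτ l))) (k l : Fin n)
    (hkl : k ≠ l) (r : ℚ) : (τ k).im * (τ l).im ≠ algebraMap ℚ ℝ r := by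
  intro h
  have hc := im_sq_ratCast_ne_zero hτ hq l
  have hyl : (τ l).im ≠ 0 := hτ l
  apply im_div_im_ne_ratCast_of_not_isIsogenous (hτ k) (hτ l) (hq k) (hq l) (hiso k l hkl) (r / (q l - p l ^ 2 / 4))
  have hy2 : (τ l).im ^ 2 = ((q l - p l ^ 2 / 4 : ℚ) : ℝ) := by
    rw [im_sq_eq_of_quadratic (hτ l) (hq l)]; push_cast; ring
  rw [eq_ratCast] at h
  have : (τ k).im / (τ l).im = (τ k).im * (τ l).im / (τ l).im ^ 2 := by
    field_simp
  rw [this, h, hy2]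
  push_cast
  ring

include hτ in
/-- **Generation: `∏ₖ hₖ(S¹) ⊆ Hg(∏ₖ E_{τₖ})(ℝ)` for pairwise non-isogenous CM curves** — every block-diagonal
`diag(h₀(e^{iθ₀}), …, h_{n−1}(e^{iθ_{n−1}}))` lies in every algebraic `ℚ`-group containing `h(S¹)`: the sign
characters `εₖ` of `Gal(ℚ(Im τ₀, …, Im τ_{n−1})/ℚ)` are pairwise distinct (`Im τₖ Im τₗ ∉ ℚ`), so the vectors
`ε(σ)` span `ℝⁿ` (`θ = ∑_σ φ_σ ε(σ)`) and `diag(hₖ(e^{iθₖ})) = ∏_σ diag(hₖ(e^{iεₖ(σ)φ_σ}))` is a product of points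
of the twisted circles of §3. This is Imai's conclusion "`eᵢ = 0` (`i = 1, ⋯, n`)" — no non-trivial character of
`G_mⁿ` vanishes on `H`. [cite: Imai1976HodgeGroups, §2 Proposition (proof, first case, pp. 368–369)]
[cite: MoonenZarhin1999LowDim, §3 Corollary] -/
theorem piBlockDiagSL_hodgeCircleSL_mem_hodgeGroup_pi {p q : Fin n → ℚ} (hq : ∀ k, τ k ^ 2 + p k * τ k + q k = 0)
    (hiso : ∀ k l, k ≠ l → ¬ IsIsogenous (ellipticPeriod (hτ k)) (ellipticPeriod (hτ l))) (θ : Fin n → ℝ) :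
    piBlockDiagSL (fun k ↦ hodgeCircleSL (ellipticPeriod (hτ k)) (θ k)) ∈
      hodgeGroup (piPeriod fun k ↦ ellipticPeriod (hτ k)) := by
  classical
  intro P hP hh
  obtain ⟨s, φ, hφ⟩ := exists_eq_sum_mul_algEquiv_gen_div Rat.isPrimitiveRoot_neg_one_two (fun k ↦ (τ k).im)
    (fun k ↦ q k - p k ^ 2 / 4) (im_sq_ratCast_ne_zero hτ hq) (im_sq_eq_algebraMap hτ hq)
    (im_mul_im_ne_ratCast_of_not_isIsogenous hτ hq hiso) θ
  -- the twisted circles lie in `G(ℝ)` (§3), at the level of `SL`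
  have hgen : ∀ (σ : kummerField ℚ (fun k ↦ (τ k).im) ≃ₐ[ℚ] kummerField ℚ (fun k ↦ (τ k).im)) (t : ℝ),
      piBlockDiagSL (fun k ↦ hodgeCircleSL (ellipticPeriod (hτ k)) (cmGalSign τ σ k * t)) ∈ hP.realPoints := by
    intro σ t
    change ((piBlockDiagSL fun k ↦ hodgeCircleSL (ellipticPeriod (hτ k)) (cmGalSign τ σ k * t)) :
      Matrix (Fin n × Fin 2) (Fin n × Fin 2) ℝ) ∈ ratZeroLocus ℝ P
    simp only [coe_piBlockDiagSL, coe_hodgeCircleSL]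
    exact piBlockDiag_hodgeCircle_sign_mem_ratZeroLocus hτ hq hh σ t
  have hkey : ∀ x y : SpecialLinearGroup (Fin n × Fin 2) ℝ, x = y → y ∈ hP.realPoints → x ∈ hP.realPoints :=
    fun x y hxy hy ↦ hxy ▸ hy
  -- induction on the finite set of automorphisms used
  suffices hind : ∀ (s' : Finset (kummerField ℚ (fun k ↦ (τ k).im) ≃ₐ[ℚ] kummerField ℚ (fun k ↦ (τ k).im)))
      (ψ : Fin n → ℝ), (∀ k, ψ k = ∑ σ ∈ s', φ σ * cmGalSign τ σ k) →
      piBlockDiagSL (fun k ↦ hodgeCircleSL (ellipticPeriod (hτ k)) (ψ k)) ∈ hP.realPoints from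
    hind s θ hφ
  intro s'
  induction s' using Finset.induction_on with
  | empty =>
    intro ψ hψ
    refine hkey _ _ ?_ hP.realPoints.one_mem
    rw [← map_one piBlockDiagSL]
    congr 1
    funext k
    apply Subtype.ext
    change hodgeCircle _ (ψ k) = 1
    rw [hψ k, Finset.sum_empty, hodgeCircle_zero]
  | insert σ s' hσ ih =>
    intro ψ hψ
    have hmul := hP.realPoints.mul_mem (hgen σ (φ σ))
      (ih (fun k ↦ ∑ σ' ∈ s', φ σ' * cmGalSign τ σ' k) fun k ↦ rfl)
    rw [← map_mul] at hmul
    refine hkey _ _ ?_ hmul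
    congr 1
    funext k
    apply Subtype.ext
    change hodgeCircle _ (ψ k) = hodgeCircle _ (cmGalSign τ σ k * φ σ) * hodgeCircle _ (∑ σ' ∈ s', φ σ' * cmGalSign τ σ' k)
    rw [← hodgeCircle_add, hψ k, Finset.sum_insert hσ, mul_comm (φ σ)]

end Density

/-! ## §4 Imai's Proposition for CM curves: `Hg(∏ₖ E_{τₖ}) = ∏ₖ Hg(E_{τₖ}) = U(1)ⁿ` -/

section Imai

variable {n : ℕ} {τ : Fin n → ℂ} (hτ : ∀ k, (τ k).im ≠ 0)

include hτ in
/-- **Imai 1976, Proposition — the case of elliptic curves with complex multiplication, any number of factors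
(= Moonen–Zarhin 1999 §3 Corollary, CM case), at torus level, real points:
`Hg(E_{τ₀} × ⋯ × E_{τ_{n−1}})(ℝ) = Hg(E_{τ₀})(ℝ) × ⋯ × Hg(E_{τ_{n−1}})(ℝ)`** (block-diagonally in
`SL(H₁(∏ E_{τₖ}, ℝ))`) for CM points `τₖ` (`τₖ² + pₖτₖ + qₖ = 0` over `ℚ`) with `E_{τₖ} ≁ E_{τₗ}` for `k ≠ l`.
`⊆` is GGK III.B (i) (`hodgeGroup_pi_le`); `⊇` is §3 together with `Hg(E_{τₖ})(ℝ) = hₖ(S¹)` (CM).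
[cite: Imai1976HodgeGroups, §2 Proposition (p. 368 L11–L13)] [cite: MoonenZarhin1999LowDim, §3 Corollary] -/
theorem hodgeGroup_pi_ellipticPeriod_eq {p q : Fin n → ℚ} (hq : ∀ k, τ k ^ 2 + p k * τ k + q k = 0)
    (hiso : ∀ k l, k ≠ l → ¬ IsIsogenous (ellipticPeriod (hτ k)) (ellipticPeriod (hτ l))) :
    hodgeGroup (piPeriod fun k ↦ ellipticPeriod (hτ k)) =
      (Subgroup.pi Set.univ fun k ↦ hodgeGroup (ellipticPeriod (hτ k))).map piBlockDiagSL := by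
  refine le_antisymm (hodgeGroup_pi_le _) ?_
  rintro M ⟨A, hA, rfl⟩
  have hθ : ∀ k, ∃ θ : ℝ, A k = hodgeCircleSL (ellipticPeriod (hτ k)) θ := fun k ↦
    (mem_hodgeGroup_ellipticPeriod_iff_of_quadratic (hτ k) (hq k)).1 (hA k (Set.mem_univ k))
  choose θ hθ using hθ
  have hAeq : A = fun k ↦ hodgeCircleSL (ellipticPeriod (hτ k)) (θ k) := funext hθ
  rw [hAeq]
  exact piBlockDiagSL_hodgeCircleSL_mem_hodgeGroup_pi hτ hq hiso θ

include hτ in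
/-- **`Hg(∏ₖ E_{τₖ})(ℝ) = {diag(h₀(e^{iθ₀}), …, h_{n−1}(e^{iθ_{n−1}}))} ≅ U(1)ⁿ`** — the real points of the
rank-`n` torus `∏ₖ 𝕌_{ℚ(τₖ)}`, for pairwise non-isogenous CM curves. [cite: Imai1976HodgeGroups, §2 Proposition (p. 368: "`Hg(E)` is a 1-dimensional torus if `E` is of CM-type")]
[cite: MoonenZarhin1999LowDim, §3 Corollary (and Proposition, proof: "`Hg(E)` is the rank 1 torus `𝕌_k`")] -/
theorem mem_hodgeGroup_pi_ellipticPeriod_iff {p q : Fin n → ℚ} (hq : ∀ k, τ k ^ 2 + p k * τ k + q k = 0)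
    (hiso : ∀ k l, k ≠ l → ¬ IsIsogenous (ellipticPeriod (hτ k)) (ellipticPeriod (hτ l)))
    {M : SpecialLinearGroup (Fin n × Fin 2) ℝ} :
    M ∈ hodgeGroup (piPeriod fun k ↦ ellipticPeriod (hτ k)) ↔
      ∃ θ : Fin n → ℝ, M = piBlockDiagSL fun k ↦ hodgeCircleSL (ellipticPeriod (hτ k)) (θ k) := by
  constructor
  · intro hM
    obtain ⟨A, hA, rfl⟩ := exists_eq_piBlockDiagSL_of_mem_hodgeGroup_pi _ hM
    have hθ : ∀ k, ∃ θ : ℝ, A k = hodgeCircleSL (ellipticPeriod (hτ k)) θ := fun k ↦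
      (mem_hodgeGroup_ellipticPeriod_iff_of_quadratic (hτ k) (hq k)).1 (hA k)
    choose θ hθ using hθ
    exact ⟨θ, congrArg _ (funext hθ)⟩
  · rintro ⟨θ, rfl⟩
    exact piBlockDiagSL_hodgeCircleSL_mem_hodgeGroup_pi hτ hq hiso θ

include hτ in
/-- The Hodge group of a product of pairwise non-isogenous CM elliptic curves is COMMUTATIVE (it is a torus —
cf. Lange Prop. 7.2.6: `Hg(X)` is commutative iff `End_ℚ(X)` contains a commutative semisimple `ℚ`-algebra of
dimension `2 dim X`, "abelian varieties of CM-type"). [cite: MoonenZarhin1999LowDim, §3 Corollary]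
[cite: Lange2023AbelianVarietiesComplex, §7.2.3 Prop. 7.2.6 (p. 332)] -/
theorem hodgeGroup_pi_ellipticPeriod_comm {p q : Fin n → ℚ} (hq : ∀ k, τ k ^ 2 + p k * τ k + q k = 0)
    (hiso : ∀ k l, k ≠ l → ¬ IsIsogenous (ellipticPeriod (hτ k)) (ellipticPeriod (hτ l)))
    {M N : SpecialLinearGroup (Fin n × Fin 2) ℝ} (hM : M ∈ hodgeGroup (piPeriod fun k ↦ ellipticPeriod (hτ k)))
    (hN : N ∈ hodgeGroup (piPeriod fun k ↦ ellipticPeriod (hτ k))) : M * N = N * M := by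
  obtain ⟨θ, rfl⟩ := (mem_hodgeGroup_pi_ellipticPeriod_iff hτ hq hiso).1 hM
  obtain ⟨θ', rfl⟩ := (mem_hodgeGroup_pi_ellipticPeriod_iff hτ hq hiso).1 hN
  rw [← map_mul, ← map_mul]
  congr 1
  funext k
  change hodgeCircleSL _ (θ k) * hodgeCircleSL _ (θ' k) = hodgeCircleSL _ (θ' k) * hodgeCircleSL _ (θ k)
  apply Subtype.ext
  change hodgeCircle _ (θ k) * hodgeCircle _ (θ' k) = hodgeCircle _ (θ' k) * hodgeCircle _ (θ k)
  rw [← hodgeCircle_add, ← hodgeCircle_add, add_comm]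

end Imai

/-! ## §5 Validation: three curves with CM by `ℚ(i)`, `ℚ(√−2)`, `ℚ(√−3)` -/

section Validation

open Literature.NumberTheory.QuadraticFields.Quadratic

/-- The CM points `i, i√2, i√3`. [cite: MoonenZarhin1999LowDim, §3 Corollary] -/
def tauThree : Fin 3 → ℂ := ![I, I * Real.sqrt 2, I * Real.sqrt 3]

/-- The constants `qₖ = 1, 2, 3` of the CM equations `τₖ² + qₖ = 0` (as integers). [cite: MoonenZarhin1999LowDim, §3 Corollary] -/
def cThree : Fin 3 → ℤ := ![1, 2, 3]

/-- `Im τₖ ≠ 0` for `τ = (i, i√2, i√3)`. [cite: MoonenZarhin1999LowDim, §3 Corollary] -/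
theorem tauThree_im_ne_zero : ∀ k : Fin 3, (tauThree k).im ≠ 0 := by
  intro k
  fin_cases k <;> simp [tauThree]

/-- `τₖ` is a root of the primitive form `x² + cₖ y²`: `τₖ² + 0·τₖ + cₖ = 0`. [cite: MoonenZarhin1999LowDim, §3 Corollary] -/
theorem tauThree_root (k : Fin 3) :
    ((1 : ℤ) : ℂ) * tauThree k ^ 2 + ((0 : ℤ) : ℂ) * tauThree k + ((cThree k : ℤ) : ℂ) = 0 := by
  have h2 : ((Real.sqrt 2 : ℝ) : ℂ) ^ 2 = 2 := by
    rw [← ofReal_pow, Real.sq_sqrt (by norm_num : (0:ℝ) ≤ 2)]; norm_num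
  have h3 : ((Real.sqrt 3 : ℝ) : ℂ) ^ 2 = 3 := by
    rw [← ofReal_pow, Real.sq_sqrt (by norm_num : (0:ℝ) ≤ 3)]; norm_num
  fin_cases k
  · change ((1 : ℤ) : ℂ) * I ^ 2 + ((0 : ℤ) : ℂ) * I + ((1 : ℤ) : ℂ) = 0
    push_cast
    linear_combination I_sq
  · change ((1 : ℤ) : ℂ) * (I * Real.sqrt 2) ^ 2 + ((0 : ℤ) : ℂ) * (I * Real.sqrt 2) + ((2 : ℤ) : ℂ) = 0
    push_cast
    linear_combination ((Real.sqrt 2 : ℝ) : ℂ) ^ 2 * I_sq - 1 * h2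
  · change ((1 : ℤ) : ℂ) * (I * Real.sqrt 3) ^ 2 + ((0 : ℤ) : ℂ) * (I * Real.sqrt 3) + ((3 : ℤ) : ℂ) = 0
    push_cast
    linear_combination ((Real.sqrt 3 : ℝ) : ℂ) ^ 2 * I_sq - 1 * h3

/-- The CM equations over `ℚ`: `τₖ² + 0·τₖ + qₖ = 0` with `q = (1, 2, 3)`. [cite: MoonenZarhin1999LowDim, §3 Corollary] -/
theorem tauThree_quadratic : ∀ k : Fin 3,
    tauThree k ^ 2 + ((fun _ ↦ (0 : ℚ)) k : ℚ) * tauThree k + ((fun k ↦ (cThree k : ℚ)) k : ℚ) = 0 := by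
  intro k
  have h := tauThree_root k
  push_cast at h ⊢
  linear_combination h

/-- `32`, `48` and `96` are not squares. [folklore] -/
private theorem not_isSquare_of_eq {D : ℤ} (hD : D = 32 ∨ D = 48 ∨ D = 96) : ¬ IsSquare D := by
  rintro ⟨r, hr⟩
  have h1 : (r.natAbs : ℤ) * r.natAbs = D := by rw [Int.natAbs_mul_self', ← hr]
  have hle : r.natAbs ≤ 10 := by
    by_contra hlt
    push Not at hlt
    have : (11 : ℤ) * 11 ≤ r.natAbs * r.natAbs := by
      have : (11 : ℤ) ≤ r.natAbs := by exact_mod_cast hlt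
      nlinarith
    rcases hD with rfl | rfl | rfl <;> omega
  rcases hD with rfl | rfl | rfl <;> interval_cases r.natAbs <;> omega

/-- **`E_i`, `E_{i√2}`, `E_{i√3}` are pairwise non-isogenous** (`DD' = 16 cₖ cₗ ∈ {32, 48, 96}` is never a
square: distinct CM fields `ℚ(i)`, `ℚ(√−2)`, `ℚ(√−3)`). [cite: MoonenZarhin1999LowDim, §3 Corollary] -/
theorem tauThree_pairwise_not_isIsogenous : ∀ k l : Fin 3, k ≠ l →
    ¬ IsIsogenous (ellipticPeriod (tauThree_im_ne_zero k)) (ellipticPeriod (tauThree_im_ne_zero l)) := by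
  intro k l hkl h
  have hprim : ∀ m : Fin 3, (⟨1, 0, cThree m⟩ : BinQF).IsPrimitive := by
    intro m; fin_cases m <;> decide
  have hsq := h.isSquare_disc_mul (tauThree_im_ne_zero k) (tauThree_im_ne_zero l) (hprim k) (hprim l)
    (tauThree_root k) (tauThree_root l)
  have hdisc : ∀ m : Fin 3, (⟨1, 0, cThree m⟩ : BinQF).disc = -4 * cThree m := fun m ↦ by
    simp [BinQF.disc]
  rw [hdisc, hdisc] at hsq
  fin_cases k <;> fin_cases l <;>
    first
    | exact absurd rfl hkl
    | (refine not_isSquare_of_eq ?_ hsq; norm_num [cThree])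

/-- **Validation instance: `Hg(E_i × E_{i√2} × E_{i√3})(ℝ) = {diag(h₀(e^{iθ₀}), h₁(e^{iθ₁}), h₂(e^{iθ₂}))}`
= `U(1)³`** — the Hodge group of the product of THREE pairwise non-isogenous CM curves is the full rank-3 torus.
[cite: MoonenZarhin1999LowDim, §3 Corollary] [cite: Imai1976HodgeGroups, §2 Proposition] -/
theorem mem_hodgeGroup_pi_tauThree_iff {M : SpecialLinearGroup (Fin 3 × Fin 2) ℝ} :
    M ∈ hodgeGroup (piPeriod fun k ↦ ellipticPeriod (tauThree_im_ne_zero k)) ↔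
      ∃ θ : Fin 3 → ℝ, M = piBlockDiagSL fun k ↦ hodgeCircleSL (ellipticPeriod (tauThree_im_ne_zero k)) (θ k) :=
  mem_hodgeGroup_pi_ellipticPeriod_iff tauThree_im_ne_zero tauThree_quadratic tauThree_pairwise_not_isIsogenous

end Validation

end ComplexTorus

end Literature.Geometry.Kaehler
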